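import Mathlib.LinearAlgebra.Lagrange
import Literature.NumberTheory.Automorphic.RootSpaceSl2
import Literature.NumberTheory.Automorphic.RootSpaceDimension
import Literature.NumberTheory.Automorphic.LieAlgebraGLTorusHull
import HarnessLib

/-!
# Root spaces are lines, from `𝔤^T ⊆ L(T)` alone (characteristic `0`)
(trunk T-AUTOMORPHIC, G25 AutomorphicL; DAG of `Literature.NumberTheory.Automorphic.chevalley_isomorphism`)

Companion to `RootSpaceSl2.lean` (brackets of weight vectors, `[H, M] = dp_1(H) M`, the
`𝔰𝔩₂`-string lemma and the count `finrank_le_one_of_sl2Data`), `RootSpaceDimension.lean`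
(`dim 𝔤_α ≤ 1 ⟹ rootSubgroup_unique`-converse, the named fact `lieWeightSpace_one_le_lieAlgebraGL`
= `𝔤^T ⊆ L(T)`, Springer 5.4.7 + 7.6.4 (ii), and 8.1.3 (ii) from it), `LieAlgebraGLTorusHull.lean`
(`conj_mem_lieAlgebraGL_map_conj`), `LieAlgebraGLDiagonal.lean` (`Lie(T)` is diagonal for
`T ≤ 𝔻ₙ`), `LieAlgebraGLNilpotentExp.lean` (exponentials, nilpotent weight vectors) and
`IsomorphismTheoremUniqueLie.lean` / `IsomorphismTheoremUniqueProofs.lean` (velocities of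
one-parameter subgroups, `SL2_normal_le_center`). Namespace `Literature.NumberTheory.Automorphic`.
Everything is proved:

* `trace_pow_eq_zero_of_commute_lie` (Jacobson: if `[e, f]` commutes with `e` its powers are
  traceless), `eq_zero_of_forall_sum_pow_eq_zero` (power sums detect `0` in characteristic `0`,
  by Lagrange interpolation), `eq_zero_of_mem_lieAlgebraGL_torus_of_trace_pow` (an element of the
  Lie algebra of a torus with vanishing power traces is `0`);
* `IsRootHom.coe_apply_eq_exp` — a root homomorphism is the exponential of its velocity;
* **`finrank_lieWeightSpace_le_one_of_lieWeightSpace_one_le`** — for `G` connected reductive over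
  an algebraically closed field of characteristic `0`, `T` a maximal torus with a root datum and
  `𝔤^T ⊆ L(T)`: **`dim 𝔤_α ≤ 1` for every root `α`** (second clause of Springer 8.1.2), via the
  `𝔰𝔩₂`-triple of the root: `e = du_α`, `f₀ = du_{-α}`, `h₁ = [e, f₀] ∈ 𝔤^T ⊆ L(T)`,
  `[h₁, e] = c e` with `c = dα(h₁) ≠ 0` — else `h₁` commutes with `e`, is traceless in all powers,
  hence `0`, so `U_α`, `U_{-α}` commute, which `SL₂` forbids — and the count of `RootSpaceSl2.lean`;
* consequences, all from `𝔤^T ⊆ L(T)` (`h0`) in characteristic `0`, given a root datum: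
  `rootSubgroup_unique_of_lieWeightSpace_one_le` (Springer 8.1.1 (i)),
  `zdim_eq_rank_add_card_roots_of_lieWeightSpace_one_le` (8.1.3 (ii)); the consequences through
  8.2.1 (`posRootGroup_eq_prod`) and the assembly of `chevalley_isomorphism` from
  `chevalley_isomorphism_abstract` and `𝔤^T ⊆ L(T)` only are in `ChevalleyIsomorphismLie.lean`.

## References

* [SpringerLAG1998] T. A. Springer, *Linear Algebraic Groups*, 2nd ed., Progress in
  Mathematics 9, Birkhäuser (1998): 4.4.15, Cor. 5.4.7, Cor. 7.6.4 (ii), 8.1.1, Cor. 8.1.2,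
  Cor. 8.1.3 (ii), Prop. 8.2.1, 8.3.11, Thm. 9.6.2 (proof).
* [Humphreys1972] J. E. Humphreys, *Introduction to Lie Algebras and Representation Theory*,
  GTM 9, Springer (1972), §7.2, §8.4.
-/

noncomputable section

open scoped MatrixGroups IsMulCommutative
open Polynomial

namespace Literature.NumberTheory.Automorphic

variable {k : Type*} [Field k] {n : Type*} [Fintype n] [DecidableEq n]

/-! ### Jacobson-type trace computation and vanishing of diagonalizable elements -/

section Traces

/-- If `h = [e, f]` commutes with `e` then all powers of `h` are commutators with `e`, hence
traceless: `h^{m+1} = e (h^m f) - (h^m f) e` (Jacobson's lemma, trace part). [folklore] -/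
theorem trace_pow_eq_zero_of_commute_lie {e f : Matrix n n k} (hc : Commute (e * f - f * e) e)
    (m : ℕ) (hm : 1 ≤ m) : Matrix.trace ((e * f - f * e) ^ m) = 0 := by
  obtain ⟨m, rfl⟩ := Nat.exists_eq_add_of_le' hm
  set h := e * f - f * e with hh
  have key : h ^ (m + 1) = e * (h ^ m * f) - (h ^ m * f) * e := by
    calc h ^ (m + 1) = h ^ m * (e * f - f * e) := pow_succ _ _
      _ = h ^ m * e * f - h ^ m * f * e := by rw [mul_sub, mul_assoc, mul_assoc]
      _ = e * h ^ m * f - h ^ m * f * e := by rw [(hc.pow_left m).eq]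
      _ = e * (h ^ m * f) - (h ^ m * f) * e := by rw [mul_assoc]
  rw [key, Matrix.trace_sub, Matrix.trace_mul_comm, sub_self]

omit [DecidableEq n] in
/-- **Power sums detect zero in characteristic `0`**: if `∑ i, d_i^m = 0` for all `m ≥ 1` then
`d = 0` (evaluate a Lagrange interpolation polynomial vanishing at `0` and at the other values,
and equal to `1` at a putative non-zero value `d_{i₀}`). [folklore] -/
theorem eq_zero_of_forall_sum_pow_eq_zero [CharZero k] (d : n → k)
    (h : ∀ m : ℕ, 1 ≤ m → ∑ i, d i ^ m = 0) : d = 0 := by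
  classical
  funext i₀
  by_contra hne
  let s : Finset k := insert 0 (Finset.univ.image d)
  have hmem : ∀ i, d i ∈ s := fun i =>
    Finset.mem_insert_of_mem (Finset.mem_image_of_mem d (Finset.mem_univ i))
  let q : k[X] := Lagrange.basis s id (d i₀)
  have hq0 : q.eval 0 = 0 := by
    have := Lagrange.eval_basis_of_ne (s := s) (v := id) (i := d i₀) (j := 0) hne
      (Finset.mem_insert_self 0 _)
    simpa using this
  have hqself : q.eval (d i₀) = 1 := by
    have := Lagrange.eval_basis_self (s := s) (v := id) (i := d i₀) (Set.injOn_id _) (hmem i₀)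
    simpa using this
  have hqother : ∀ i, d i ≠ d i₀ → q.eval (d i) = 0 := by
    intro i hi
    have := Lagrange.eval_basis_of_ne (s := s) (v := id) (i := d i₀) (j := d i) (Ne.symm hi) (hmem i)
    simpa using this
  -- `∑ i, q (d i)` computed in two ways
  have hsum1 : ∑ i, q.eval (d i) = ((Finset.univ.filter fun i => d i = d i₀).card : k) := by
    rw [← Finset.sum_boole]
    refine Finset.sum_congr rfl fun i _ => ?_
    by_cases hi : d i = d i₀
    · rw [if_pos hi, hi, hqself]
    · rw [if_neg hi, hqother i hi]
  have hsum2 : ∑ i, q.eval (d i) = 0 := by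
    simp_rw [Polynomial.eval_eq_sum_range]
    rw [Finset.sum_comm]
    refine Finset.sum_eq_zero fun m _ => ?_
    rw [← Finset.mul_sum]
    rcases m with _ | m
    · simp only [pow_zero, Finset.sum_const, Finset.card_univ, nsmul_eq_mul, mul_one]
      rw [Polynomial.coeff_zero_eq_eval_zero, hq0, zero_mul]
    · rw [h (m + 1) (Nat.succ_pos m), mul_zero]
  have hcard : ((Finset.univ.filter fun i => d i = d i₀).card : k) ≠ 0 := by
    exact_mod_cast (Finset.card_pos.2 ⟨i₀, by simp⟩).ne'
  exact hcard (hsum1 ▸ hsum2)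

variable {T : Subgroup (GL n k)}

/-- **An element of the Lie algebra of a torus with vanishing power traces is zero**
(characteristic `0`): `Lie(T)` is diagonal in a frame diagonalising `T`
(`exists_eq_diagonal_of_mem_lieAlgebraGL`, `conj_mem_lieAlgebraGL_map_conj`), and the power sums of
the diagonal entries are the traces of the powers. [folklore] -/
theorem eq_zero_of_mem_lieAlgebraGL_torus_of_trace_pow [IsAlgClosed k] [CharZero k]
    (hT : IsTorusSubgroup T) {H : Matrix n n k} (hH : H ∈ lieAlgebraGL T)
    (htr : ∀ m : ℕ, 1 ≤ m → Matrix.trace (H ^ m) = 0) : H = 0 := by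
  obtain ⟨A, hA⟩ := exists_conj_le_diagonalSubgroup hT.2.1 hT.2.2
  have hD := conj_mem_lieAlgebraGL_map_conj A hH
  obtain ⟨d, hd⟩ := exists_eq_diagonal_of_mem_lieAlgebraGL hA hD
  have hdm : ∀ m : ℕ, 1 ≤ m → ∑ i, d i ^ m = 0 := by
    intro m hm
    have e1 : Matrix.trace ((Matrix.diagonal d) ^ m) = Matrix.trace (H ^ m) := by
      rw [← hd, Units.conj_pow, Matrix.trace_units_conj]
    rw [Matrix.diagonal_pow, Matrix.trace_diagonal, htr m hm] at e1
    simpa using e1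
  have hd0 : d = 0 := eq_zero_of_forall_sum_pow_eq_zero d hdm
  rw [hd0] at hd
  have hd' : (A : Matrix n n k) * H * ((A⁻¹ : GL n k) : Matrix n n k) = 0 := by
    rw [hd]; exact Matrix.diagonal_zero
  -- `H = A⁻¹ 0 A = 0`
  have : H = ((A⁻¹ : GL n k) : Matrix n n k) * ((A : Matrix n n k) * H * ((A⁻¹ : GL n k) : Matrix n n k)) *
      (A : Matrix n n k) := by
    simp [Matrix.mul_assoc]
  rw [this, hd', Matrix.mul_zero, Matrix.zero_mul]

end Traces

/-! ### The `𝔰𝔩₂`-triple of a root and `dim 𝔤_α ≤ 1` from `𝔤^T ⊆ L(T)` -/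

section Main

variable {ι X Y : Type*} [AddCommGroup X] [AddCommGroup Y]
variable {G T : Subgroup (GL n k)} [IsMulCommutative ↥T]
variable {P : RootPairing ι ℤ X Y} {eX : Additive ↥(characterLattice T) ≃+ X}
  {eY : Additive ↥(cocharacterLattice T) ≃+ Y}

omit [IsMulCommutative ↥T] in
/-- A root homomorphism is the exponential of its velocity (characteristic `0`): `u(x) = exp (x du)`
for the velocity `du ∈ Lie(G)` (nilpotent for a non-trivial weight), by uniqueness of algebraic
one-parameter subgroups with given velocity (`IsAlgebraicAddHom.eq_of_velocity_eq_smul`) and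
`expHom_mem_of_mem_lieAlgebraGL`. [folklore] -/
theorem IsRootHom.coe_apply_eq_exp [CharZero k] (hG : IsAlgebraicSubgroup G) {hTG : T ≤ G}
    {α : ↥T →* kˣ} {u : Multiplicative k →* ↥G} (hu : IsRootHom G T hTG α u)
    (hn : IsNilpotent hu.1.velocity) (x : k) :
    ((u (Multiplicative.ofAdd x) : ↥G) : GL n k) = expHom hu.1.velocity hn (Multiplicative.ofAdd x) := by
  have heL : hu.1.velocity ∈ lieAlgebraGL G := by
    refine hu.1.velocity_mem_lieAlgebraGL ?_
    rintro _ ⟨g, -, rfl⟩; exact g.2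
  set uexp : Multiplicative k →* ↥G := (expHom hu.1.velocity hn).codRestrict G
    (fun y => expHom_mem_of_mem_lieAlgebraGL hG heL hn y) with huexp_def
  have huexp : IsAlgebraicAddHom uexp :=
    isAlgebraicAddHom_codRestrict_expHom hn fun y => expHom_mem_of_mem_lieAlgebraGL hG heL hn y
  obtain ⟨N, hN⟩ := id hn
  have hN2 : hu.1.velocity ^ (N + 2) = 0 := by rw [pow_add, hN, zero_mul]
  have hvel : huexp.velocity = hu.1.velocity := by
    rw [huexp.velocity_eq (expCurve hu.1.velocity (N + 2)) (fun y c => ?_)]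
    · ext i j
      rw [Matrix.of_apply, coeff_one_expCurve_inl]
    · rw [eval_expCurve hn hN2 y c]
      rfl
  have key := hu.1.eq_of_velocity_eq_smul huexp (c := 1) (by rw [hvel, one_smul]) x
  rw [one_mul] at key
  have := congrArg (fun g : ↥G => (g : GL n k)) key
  simpa [huexp_def] using this.symm

/-- **`dim 𝔤_α ≤ 1` for every root, from `𝔤^T ⊆ L(T)` alone (characteristic `0`).** Let `G` be
connected reductive over an algebraically closed field of characteristic `0`, `T` a maximal torus
with root datum `P`, and suppose `𝔤^T = lieWeightSpace G T 1 ⊆ Lie(T)` (Springer 5.4.7 with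
7.6.4 (ii); the named fact `lieWeightSpace_one_le_lieAlgebraGL`). Then every root space
`𝔤_{α_i}` has dimension `≤ 1` — the second clause of Springer 8.1.2, here derived through the
Lie algebra instead of the groups `G_α` of semisimple rank one: with `e = du_α`, `f₀ = du_{-α}`
(velocities of the root homomorphisms of the `SL₂` of the root datum), `h₁ = [e, f₀] ∈ 𝔤^T ⊆ L(T)`
and `c = dα(h₁)`, one has `[h₁, e] = c e`; `c ≠ 0` (otherwise `h₁` commutes with `e`, all
`tr h₁^m` vanish, so `h₁ = 0` being in the Lie algebra of a torus, so `U_α` and `U_{-α}` commute,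
which the `SL₂` forbids: a normal subgroup of `SL₂(k)` avoiding the upper unipotents is central,
`SL2_normal_le_center`, but `(u(1), u⁻(1))` is not); rescaling gives an `𝔰𝔩₂`-triple and
`finrank_le_one_of_sl2Data` applies with `S = 𝔤_α`, `W = L(T)`.
[cite: SpringerLAG1998, Cor. 8.1.2] -/
theorem finrank_lieWeightSpace_le_one_of_lieWeightSpace_one_le [IsAlgClosed k] [CharZero k]
    (hG : IsConnectedReductive G) (hT : IsMaximalTorusIn T G)
    (h0 : lieWeightSpace G T 1 ≤ lieAlgebraGL T) (h : IsRootDatumOf G T P eX eY) (i : ι) :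
    Module.finrank k ↥(lieWeightSpace G T (charOfWeight eX (P.root i))) ≤ 1 := by
  have hGa : IsAlgebraicSubgroup G := hG.1.1
  have hTt : IsTorusSubgroup T := hT.2.1
  have hTc : IsZConnected T := hTt.1
  set α : ↥T →* kˣ := charOfWeight eX (P.root i) with hαdef
  have hαalg : IsAlgebraicChar α := (Additive.toMul (eX.symm (P.root i))).2
  obtain ⟨p, hp⟩ := id hαalg
  have hα1 : α ≠ 1 := by
    obtain ⟨β, hβ, hβi⟩ := h.exists_root_eq i
    rw [hαdef, ← hβi]; exact hβ.1
  have hα1' : α⁻¹ ≠ 1 := by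
    intro h1; apply hα1
    refine MonoidHom.ext fun t => ?_
    have h2 := DFunLike.congr_fun h1 t
    rw [MonoidHom.inv_apply, MonoidHom.one_apply, inv_eq_one] at h2
    rw [h2, MonoidHom.one_apply]
  -- the `SL₂` of the root and the two velocities
  obtain ⟨φ, -, hu, hu', -⟩ := h.exists_sl2Hom i
  set e : Matrix n n k := hu.1.velocity with hedef
  set f₀ : Matrix n n k := hu'.1.velocity with hf₀def
  have he : e ∈ lieWeightSpace G T α := hu.velocity_mem_lieWeightSpace
  have hf₀ : f₀ ∈ lieWeightSpace G T α⁻¹ := hu'.velocity_mem_lieWeightSpace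
  have hen : IsNilpotent e := isNilpotent_of_mem_weightSpaceGL hTc hαalg hα1 he.2
  have hf₀n : IsNilpotent f₀ := isNilpotent_of_mem_weightSpaceGL hTc hαalg.inv hα1' hf₀.2
  -- `h₁ = [e, f₀] ∈ 𝔤^T ⊆ L(T)`
  have hlie1 : ∀ {a b : Matrix n n k}, a ∈ lieWeightSpace G T α → b ∈ lieWeightSpace G T α⁻¹ →
      a * b - b * a ∈ lieAlgebraGL T := by
    intro a b ha hb
    refine h0 ⟨lie_mem_lieAlgebraGL ha.1 hb.1, ?_⟩
    have hw := lie_mem_weightSpaceGL ha.2 hb.2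
    have e1 : α * α⁻¹ = 1 := mul_inv_cancel α
    rwa [e1] at hw
  have hlie2 : ∀ {a b : Matrix n n k}, a ∈ lieWeightSpace G T α⁻¹ → b ∈ lieWeightSpace G T α →
      a * b - b * a ∈ lieAlgebraGL T := by
    intro a b ha hb
    have := hlie1 hb ha
    rw [← neg_sub]
    exact Submodule.neg_mem _ this
  set h₁ : Matrix n n k := e * f₀ - f₀ * e with hh₁def
  have hh₁T : h₁ ∈ lieAlgebraGL T := hlie1 he hf₀
  set c : k := tangentDeriv p h₁ with hcdef
  have hce : ∀ v ∈ weightSpaceGL T α, h₁ * v - v * h₁ = c • v := fun v hv =>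
    lie_eq_tangentDeriv_smul_of_mem_weightSpaceGL hp hv hh₁T
  -- `c ≠ 0`
  have hc : c ≠ 0 := by
    intro hc0
    -- `h₁` commutes with `e`, hence is traceless in all powers, hence `0`
    have hcomm : Commute h₁ e := by
      have := hce e he.2
      rw [hc0, zero_smul, sub_eq_zero] at this
      exact this
    have htr : ∀ m : ℕ, 1 ≤ m → Matrix.trace (h₁ ^ m) = 0 := fun m hm =>
      trace_pow_eq_zero_of_commute_lie hcomm m hm
    have hh₁0 : h₁ = 0 := eq_zero_of_mem_lieAlgebraGL_torus_of_trace_pow hTt hh₁T htr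
    have hef : Commute e f₀ := by
      have : e * f₀ - f₀ * e = 0 := hh₁0
      exact sub_eq_zero.1 this
    -- hence the root groups `u(𝔾ₐ)`, `u'(𝔾ₐ)` commute
    have hgrp : ∀ x y : k, (φ.comp unipotentUpperSL2) (Multiplicative.ofAdd x) *
        (φ.comp unipotentLowerSL2) (Multiplicative.ofAdd y) =
        (φ.comp unipotentLowerSL2) (Multiplicative.ofAdd y) *
        (φ.comp unipotentUpperSL2) (Multiplicative.ofAdd x) := by
      intro x y
      apply Subtype.ext
      rw [Subgroup.coe_mul, Subgroup.coe_mul, hu.coe_apply_eq_exp hGa hen x,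
        hu'.coe_apply_eq_exp hGa hf₀n y]
      apply Units.ext
      simp only [Units.val_mul, coe_expHom_apply, toAdd_ofAdd]
      have hc2 : Commute (x • e) (y • f₀) := (hef.smul_left x).smul_right y
      rw [← IsNilpotent.exp_add_of_commute hc2 (hen.smul x) (hf₀n.smul y),
        ← IsNilpotent.exp_add_of_commute hc2.symm (hf₀n.smul y) (hen.smul x), add_comm]
    -- so all commutators `(U x, L y)` lie in `ker φ`, which avoids the upper unipotents
    have hker : ∀ x : k, unipotentUpperSL2 (Multiplicative.ofAdd x) ∈ φ.ker → x = 0 := by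
      intro x hx
      rw [MonoidHom.mem_ker] at hx
      have h1 : (φ.comp unipotentUpperSL2) (Multiplicative.ofAdd x) =
          (φ.comp unipotentUpperSL2) (Multiplicative.ofAdd 0) := by
        rw [MonoidHom.comp_apply, hx, ofAdd_zero, map_one]
      exact Multiplicative.ofAdd.injective (hu.injective h1)
    have hcenter := SL2_normal_le_center φ.ker hker
    set U1 : SL(2, k) := unipotentUpperSL2 (Multiplicative.ofAdd (1 : k)) with hU1
    set L1 : SL(2, k) := unipotentLowerSL2 (Multiplicative.ofAdd (1 : k)) with hL1
    have hmem : U1 * L1 * U1⁻¹ * L1⁻¹ ∈ φ.ker := by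
      have hc11 : φ U1 * φ L1 = φ L1 * φ U1 := by
        have := hgrp 1 1
        simpa only [MonoidHom.comp_apply] using this
      rw [MonoidHom.mem_ker, map_mul, map_mul, map_mul, map_inv, map_inv, hc11]
      group
    have hz := (Subgroup.mem_center_iff.1 (hcenter hmem)) U1
    have hz' := congrArg (fun g : SL(2, k) => (g : Matrix (Fin 2) (Fin 2) k) 0 0) hz
    simp only [hU1, hL1, Matrix.SpecialLinearGroup.coe_mul, Matrix.SpecialLinearGroup.coe_inv,
      coe_unipotentUpperSL2, coe_unipotentLowerSL2, toAdd_ofAdd, Matrix.adjugate_fin_two,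
      Matrix.mul_apply, Fin.sum_univ_two, Matrix.of_apply, Matrix.cons_val', Matrix.cons_val_zero,
      Matrix.cons_val_one, Matrix.empty_val', Matrix.cons_val_fin_one] at hz'
    norm_num at hz'
  -- the `𝔰𝔩₂`-triple `(e, f, hh)` with `f = (2/c) f₀`, `hh = (2/c) h₁`
  set f : Matrix n n k := (2 / c) • f₀ with hfdef
  set hh : Matrix n n k := (2 / c) • h₁ with hhhdef
  have h2c : (2 / c) * c = 2 := div_mul_cancel₀ 2 hc
  have hhe : hh * e - e * hh = (2 : k) • e := by
    rw [hhhdef, smul_mul_assoc, mul_smul_comm, ← smul_sub, hce e he.2, smul_smul, h2c]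
  have hef : e * f - f * e = hh := by
    rw [hfdef, mul_smul_comm, smul_mul_assoc, ← smul_sub]
  have hhv : ∀ v ∈ lieWeightSpace G T α, hh * v - v * hh = (2 : k) • v := by
    intro v hv
    rw [hhhdef, smul_mul_assoc, mul_smul_comm, ← smul_sub, hce v hv.2, smul_smul, h2c]
  have hfS : ∀ v ∈ lieWeightSpace G T α, f * v - v * f ∈ lieAlgebraGL T := by
    intro v hv
    rw [hfdef, smul_mul_assoc, mul_smul_comm, ← smul_sub]
    exact Submodule.smul_mem _ _ (hlie2 hf₀ hv)
  exact finrank_le_one_of_sl2Data hTt.2.2 hTc hαalg hα1 hp (W := lieAlgebraGL T) le_rfl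
    (S := lieWeightSpace G T α) inf_le_right he.2 hhe hef hhv hfS

end Main

/-! ### Consequences: the structure-theory leaves from `𝔤^T ⊆ L(T)` -/

section Consequences

variable {ι X Y : Type*} [AddCommGroup X] [AddCommGroup Y]
variable {G T : Subgroup (GL n k)} [IsMulCommutative ↥T]
variable {P : RootPairing ι ℤ X Y} {eX : Additive ↥(characterLattice T) ≃+ X}
  {eY : Additive ↥(cocharacterLattice T) ≃+ Y}

/-- **Springer 8.1.1 (i) (`rootSubgroup_unique`) for `(G, T)` from `𝔤^T ⊆ L(T)`**, over an
algebraically closed field of characteristic `0`, granted a root datum of `(G, T)` (to produce the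
`SL₂` of each root): every root is `α_i` for some `i` (`range_root`), its root space has dimension
`≤ 1` (`finrank_lieWeightSpace_le_one_of_lieWeightSpace_one_le`), and
`rootSubgroup_unique_of_finrank_le_one` applies. [cite: SpringerLAG1998, 8.1.1 (i) and Cor. 8.1.2] -/
theorem rootSubgroup_unique_of_lieWeightSpace_one_le [IsAlgClosed k] [CharZero k]
    (hG : IsConnectedReductive G) (hT : IsMaximalTorusIn T G)
    (h0 : lieWeightSpace G T 1 ≤ lieAlgebraGL T) (h : IsRootDatumOf G T P eX eY) :
    rootSubgroup_unique (G := G) (T := T) := by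
  refine rootSubgroup_unique_of_finrank_le_one fun α hα => ?_
  have hmem : eX (Additive.ofMul α) ∈ Set.range P.root := by
    rw [h.range_root]; exact ⟨α, hα, rfl⟩
  obtain ⟨i, hi⟩ := hmem
  have hαi : charOfWeight eX (P.root i) = (α : ↥T →* kˣ) := by simp [charOfWeight, hi]
  rw [← hαi]
  exact finrank_lieWeightSpace_le_one_of_lieWeightSpace_one_le hG hT h0 h i

/-- **Springer 8.1.3 (ii) (`zdim_eq_rank_add_card_roots`, `dim G = dim T + |R|`) from `𝔤^T ⊆ L(T)`
alone**, characteristic `0`. [cite: SpringerLAG1998, Cor. 8.1.3 (ii)] -/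
theorem zdim_eq_rank_add_card_roots_of_lieWeightSpace_one_le [CharZero k]
    (h0 : lieWeightSpace_one_le_lieAlgebraGL G T) :
    zdim_eq_rank_add_card_roots (ι := ι) (X := X) (Y := Y) G T := by
  intro _ hG hT P eX eY h
  exact zdim_eq_rank_add_card_roots_of_rootSubgroup_unique
    (rootSubgroup_unique_of_lieWeightSpace_one_le hG hT (h0 hG hT) h) h0 hG hT h

end Consequences

end Literature.NumberTheory.Automorphic
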